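import Summits.BirchSwinnertonDyer.BirchSwinnertonDyer.Theses.EisensteinCountDoorRankTwo
import Summits.BirchSwinnertonDyer.Rank1Residual.X2.EulerFactorInvariants
import Literature.NumberTheory.EllipticCurves.KatoRankBoundProofs
import Literature.NumberTheory.EllipticCurves.Rank1Residual.GVParityTwistProofs
import Literature.NumberTheory.EllipticCurves.SkinnerUrban2014.ShaOrderOfMainConjectureProofs
import HarnessLib

/-!
# BirchSwinnertonDyer / EisensteinCountDoorRankTwo — the DOOR KERNEL (support item
# stmt-BirchSwinnertonDyer-23555 `EisensteinCountDoorKernel`)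

Route `route-BirchSwinnertonDyer-EisensteinCountDoorRankTwo` (D-0145 ideator line bsd-idea-4 #3;
director-bsd W-59: T-tier DOOR target «T-r2E»; W-59 (b): "23555 provable-now support may be closed by
anyone idle"). The item: from the print pack `PublishedInputs` — (i) Greenberg–Vatsal 2000 §3
Thm. (3.11) + (28) + p. 43 at a GOOD ORDINARY Eisenstein prime with the rational `p`-line `Φ₀`
ramified at `p` and even (`μ(L_{Σ₀}) = 0` and `p^{λ(L_{Σ₀})} = #H¹(ℚ_Σ/ℚ_∞, Φ₀) · #U`), (ii) Wuthrich
2014 Thm. 16 (`char_Λ X ∣ (L_p)` integrally in the reducible case), (iii) modularity, (iv) the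
period ratio `ϖ ≠ 0`, `ϖ · Ω_W = Ω⁺_f`, (v) Kato Thm. 18.4 (`corank Sel_{p^∞} ≤ ord_T L_p`) — if
`W/ℚ` is good ordinary at the odd prime `p` with a rational `p`-line `Φ₀` ramified and even, `κ` is
cyclotomic, `Σ₀ ∌ p` covers the bad places and the Greenberg–Vatsal residual count
`#H¹ · #U` equals `p^(k + Σ_{ℓ∈Σ₀} δ_ℓ)`, then for the newform `f` of `W`,
`corank Sel_{p^∞}(W) ≤ ord_T L_p(f, α_W) ≤ k`.

PROOF (the planner's plan M, verbatim): Wuthrich gives `g ∈ Λ` (in `char X`, for SOME cyclotomic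
datum `(κ₀, γ₀, D)` — the discharged facts `exists_isCyclotomic_isTopGenerator_isCyclotomicVariable`
and `nonempty_selmerDualData`; `g` itself is `κ`-free) with `ι g = C(ϖ) · L_p(f, α)`; GV (i) with
`b := g` and the binder's `κ` gives unit content of `g · ∏_{ℓ∈Σ₀} 𝒫_ℓ` and
`p^{ord_T((g·∏𝒫) mod p)} = #H¹ · #U = p^(k + Σδ)`; display (9) in the kernel
(`X2.EulerFactorInvariants.order_map_toZMod_mul_eulerFactorProduct`: `ord_T((b·∏𝒫) mod p) =
ord_T(b mod p) + Σδ`, `p` odd) cancels `Σδ`, so `ord_T(g mod p) = k`; orders do not drop under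
reduction mod `p` (`PowerSeries.le_order_map`) and `ι` preserves them, and `C(ϖ)` is a unit of
`ℚ_p⟦T⟧`, so `ord_T L_p = ord_T g ≤ k`; Kato (v) is the lower bound. Reducibility of `E[p]` for
Wuthrich is `Rank1Residual.not_hasIrreducibleModPGaloisRep_of_isRationalLine`.

This is a DOOR kernel: nothing here proves a class theorem at rank `≥ 2`; BSD is NOT proved by it.
PARTITION: none — r_an ≥ 2, summit axis S0; TWIN (D-0056): n/a. B1 honesty: order bookkeeping in
`Λ = ℤ_p⟦T⟧` on top of five published inputs taken as hypotheses (the item's own antecedent);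
nothing reads an analytic rank.
-/

set_option linter.dupNamespace false
set_option autoImplicit false

noncomputable section

open scoped Classical

namespace Summit.BirchSwinnertonDyer.BirchSwinnertonDyer.Theorems

open NumberField IsDedekindDomain WeierstrassCurve
  Literature.NumberTheory.EllipticCurves Literature.NumberTheory.EllipticCurves.GreenbergVatsal2000
  Literature.NumberTheory.EllipticCurves.ModularForms
  Literature.NumberTheory.EllipticCurves.Rank1Residual
  Summit.BirchSwinnertonDyer.Rank1Residual.X2.EulerFactorInvariants
  Summit.BirchSwinnertonDyer.BirchSwinnertonDyer.Theses.EisensteinCountDoorRankTwo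

namespace EisensteinCountDoor

variable {p : ℕ} [hp : Fact p.Prime]

/-- If `ι b = C(ϖ) · L` with `ϖ ∈ ℚ` non-zero, then `ord_{T=0} L = ord_{T=0} b`: `C(ϖ)` is a unit of
the domain `ℚ_p⟦T⟧` and `ι` preserves orders (`order_iwasawaToPowerSeries`). (The shape of Wuthrich's Thm. 16 conclusion
`ι g = C(ϖ) · L_p(f, α)`.) [cite: Wuthrich2014, Thm. 16 (p. 397)] -/
theorem order_eq_of_iwasawaToPowerSeries_eq_C_mul {b : IwasawaAlgebra p} {ϖ : ℚ} (hϖ : ϖ ≠ 0)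
    {L : PowerSeries ℚ_[p]}
    (h : iwasawaToPowerSeries p b = PowerSeries.C ((ϖ : ℚ) : ℚ_[p]) * L) :
    L.order = b.order := by
  have hu : IsUnit (PowerSeries.C ((ϖ : ℚ) : ℚ_[p])) := by
    rw [PowerSeries.isUnit_iff_constantCoeff, PowerSeries.constantCoeff_C]
    exact isUnit_iff_ne_zero.mpr (by exact_mod_cast hϖ)
  rw [← order_iwasawaToPowerSeries p b, h, PowerSeries.order_mul,
    PowerSeries.order_zero_of_unit hu, zero_add]

/-- **From the residual COUNT to `λ = k`** (GV display (9) cancelled): if `b · ∏_{ℓ∈Σ₀} 𝒫_ℓ ∈ Λ`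
has unit content and `p^{ord_T((b·∏𝒫) mod p)} = p^(k + Σ_{ℓ∈Σ₀} δ_ℓ)` (`p` odd, `Σ₀ ∌ p`), then
`ord_T(b mod p) = k`. [cite: GreenbergVatsal2000, §1 (9) (p. 9) and Prop. (2.4)] -/
theorem order_map_toZMod_eq_of_count (W : WeierstrassCurve ℚ)
    (S₀ : Finset (HeightOneSpectrum (𝓞 ℚ))) (hp2 : p ≠ 2)
    (hS₀ : ∀ v ∈ S₀, ((p : ℕ) : 𝓞 ℚ) ∉ v.asIdeal) {b : IwasawaAlgebra p} {k : ℕ}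
    (hu : HasUnitContent (b * eulerFactorProduct W p S₀))
    (hcount : p ^ (PowerSeries.map (PadicInt.toZMod (p := p))
        (b * eulerFactorProduct W p S₀)).order.toNat = p ^ (k + ∑ v ∈ S₀, delta W p v)) :
    (PowerSeries.map (PadicInt.toZMod (p := p)) b).order = k := by
  have hS₀' : ∀ v ∈ S₀, Rat.HeightOneSpectrum.natGenerator v ≠ p :=
    fun v hv ↦ natGenerator_ne_of_natCast_not_mem v (hS₀ v hv)
  have hexp : (PowerSeries.map (PadicInt.toZMod (p := p))
      (b * eulerFactorProduct W p S₀)).order.toNat = k + ∑ v ∈ S₀, delta W p v :=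
    Nat.pow_right_injective hp.out.two_le hcount
  have hne : PowerSeries.map (PadicInt.toZMod (p := p)) (b * eulerFactorProduct W p S₀) ≠ 0 :=
    (hasUnitContent_iff_map_toZMod_ne_zero _).mp hu
  have hfin : (PowerSeries.map (PadicInt.toZMod (p := p)) (b * eulerFactorProduct W p S₀)).order =
      ((k + ∑ v ∈ S₀, delta W p v : ℕ) : ℕ∞) := by
    rw [← hexp, PowerSeries.coe_toNat_order hne]
  rw [order_map_toZMod_mul_eulerFactorProduct W S₀ hp2 hS₀' b, Nat.cast_add] at hfin
  exact WithTop.add_right_cancel (ENat.coe_ne_top _) hfin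

/-- **The door kernel with the five published inputs as separate hypotheses** (GV (i), Wuthrich
(ii), period ratio (iv), Kato (v); modularity (iii) is used only to produce `f` and is not needed
once `f` is given): `W/ℚ` good ordinary at the odd prime `p`, `Φ₀ ≤ E[p]` a rational line ramified at
`p` and even, `κ` cyclotomic, `Σ₀ ∌ p` finite covering the bad places, `f` the newform of `W`, and
`#H¹(ℚ_Σ/ℚ_∞, Φ₀) · #U = p^(k + Σδ)`; then `corank Sel_{p^∞}(W) ≤ ord_T L_p(f, α_W) ≤ k`.
[cite: GreenbergVatsal2000, §3 Thm. (3.11), (28) and p. 43] [cite: Wuthrich2014, Thm. 16 (p. 397)]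
[cite: Kato2004Asterisque, Thm. 18.4 (p. 281)] -/
theorem selmerCorank_le_order_le_of_count
    (hGV : nonPrimitive_unitContent_and_lambda_eq_residual_of_lineRamifiedEven_goodOrd)
    (hW16 : Wuthrich2014.charIdeal_dvd_padicLFunction)
    (hϖ : ∀ (W : WeierstrassCurve ℚ) [W.IsElliptic] [W.IsGloballyMinimal] {N : ℕ} [NeZero N]
      (f : CuspForm (CongruenceSubgroup.Gamma0 N) 2), IsNewformOf W f →
      ∃ ϖ : ℚ, ϖ ≠ 0 ∧ (ϖ : ℝ) * W.realPeriodRat = plusPeriod f)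
    (hKato : ∀ (W : WeierstrassCurve ℚ) [W.IsElliptic] [W.IsGloballyMinimal] (p : ℕ) [Fact p.Prime]
      {N : ℕ} [NeZero N] (f : CuspForm (CongruenceSubgroup.Gamma0 N) 2),
      kato_selmerCorank_le_order_padicLFunction_allPrimes W p (f := f))
    (W : WeierstrassCurve ℚ) [W.IsElliptic] [W.IsGloballyMinimal] (k : ℕ) (hp2 : p ≠ 2)
    (hgood : W.HasGoodReductionAtPrime p) (hord : ¬ (p : ℤ) ∣ W.frobeniusTrace p)
    {Φ₀ : AddSubgroup (W.geomTorsion (p : ℤ))} (hΦ : IsRationalLine W p Φ₀)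
    (hram : ¬ LineUnramifiedAt W p Φ₀) (heven : LineEven W p Φ₀)
    (κ : ZpExtension ℚ p) (hκ : κ.IsCyclotomic)
    (S₀ : Finset (HeightOneSpectrum (𝓞 ℚ))) (hS₀ : ∀ v ∈ S₀, ((p : ℕ) : 𝓞 ℚ) ∉ v.asIdeal)
    (hS : ∀ v : HeightOneSpectrum (𝓞 ℚ), v ∉ S₀ → ((p : ℕ) : 𝓞 ℚ) ∉ v.asIdeal →
      W.HasGoodReductionAt v)
    {N : ℕ} [NeZero N] (f : CuspForm (CongruenceSubgroup.Gamma0 N) 2) (hf : IsNewformOf W f)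
    (hcount : Nat.card (residualLineH1 W p κ S₀ Φ₀ hΦ) * Nat.card (residualQuotSelmer W p κ S₀ Φ₀ hΦ) =
      p ^ (k + ∑ v ∈ S₀, delta W p v)) :
    (W.selmerCorank p : ℕ∞) ≤ (padicLFunction f (unitRoot W p : ℚ_[p])).order ∧
      (padicLFunction f (unitRoot W p : ℚ_[p])).order ≤ (k : ℕ∞) := by
  have hordin : IsOrdinaryAt W p := ⟨hgood, hord⟩
  refine ⟨hKato W p f hordin hf, ?_⟩
  obtain ⟨ϖ, hϖ0, hϖ⟩ := hϖ W f hf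
  -- Wuthrich Thm. 16 for SOME cyclotomic datum (κ₀, γ₀, D): `g ∈ Λ` with `ι g = C(ϖ) · L_p`
  obtain ⟨κ₀, hκ₀, γ₀, hγ₀, hγ₀'⟩ := exists_isCyclotomic_isTopGenerator_isCyclotomicVariable_holds p
  obtain ⟨D⟩ := WeierstrassCurve.nonempty_selmerDualData_holds W κ₀ γ₀ hγ₀
  have hred : ¬ W.HasIrreducibleModPGaloisRep p :=
    not_hasIrreducibleModPGaloisRep_of_isRationalLine hΦ
  obtain ⟨-, g, -, hg⟩ := hW16 W p hp2 hordin hred hκ₀ hγ₀ hγ₀' hf D ϖ hϖ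
  -- GV §3 with `b := g` and the binder's `κ`: unit content and the count for `g · ∏𝒫`
  obtain ⟨hu, hC⟩ := hGV W p κ f S₀ Φ₀ hΦ hp2 hgood hord hκ hram heven hf hS₀ hS ϖ hϖ g hg
  rw [hcount] at hC
  have hk := order_map_toZMod_eq_of_count W S₀ hp2 hS₀ hu hC
  rw [order_eq_of_iwasawaToPowerSeries_eq_C_mul hϖ0 hg, ← hk]
  exact PowerSeries.le_order_map _

end EisensteinCountDoor

/-- **The support item `EisensteinCountDoorKernel` of route `EisensteinCountDoorRankTwo` holds**
(stmt-BirchSwinnertonDyer-23555): from `PublishedInputs`, for `W/ℚ` good ordinary at the odd prime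
`p` with a rational `p`-line `Φ₀` ramified and even, `κ` cyclotomic, `Σ₀ ∌ p` covering the bad
places and residual count `p^(k + Σδ)`, the newform `f` of `W` (modularity, input (iii)) satisfies
`corank Sel_{p^∞}(W) ≤ ord_T L_p(f, α_W) ≤ k` (`EisensteinCountDoor.selmerCorank_le_order_le_of_count`).
[cite: GreenbergVatsal2000, §3 Thm. (3.11), (28) and p. 43] [cite: Wuthrich2014, Thm. 16 (p. 397)]
[cite: Kato2004Asterisque, Thm. 18.4 (p. 281)] [cite: DiamondShurman2005, Thm. 8.8.3] -/
theorem eisensteinCountDoorKernel_proof :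
    Summit.BirchSwinnertonDyer.BirchSwinnertonDyer.Theses.EisensteinCountDoorRankTwo.EisensteinCountDoorKernel := by
  unfold Summit.BirchSwinnertonDyer.BirchSwinnertonDyer.Theses.EisensteinCountDoorRankTwo.EisensteinCountDoorKernel
    Summit.BirchSwinnertonDyer.BirchSwinnertonDyer.Theses.EisensteinCountDoorRankTwo.PublishedInputs
  intro hIn W _ _ p _ k hp2 hgood hord Φ₀ hΦ hram heven κ hκ S₀ hS₀ hS hcount
  obtain ⟨hGV, hW16, hmod, hϖ, hKato⟩ := hIn
  haveI : NeZero (W.conductorNorm ℤ) := ⟨(W.conductorNorm_pos_holds).ne'⟩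
  obtain ⟨f, hf⟩ := hmod W
  exact ⟨W.conductorNorm ℤ, inferInstance, f, hf,
    EisensteinCountDoor.selmerCorank_le_order_le_of_count hGV hW16 hϖ hKato W k hp2 hgood hord hΦ
      hram heven κ hκ S₀ hS₀ hS f hf hcount⟩

end Summit.BirchSwinnertonDyer.BirchSwinnertonDyer.Theorems

end
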